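import Summits.NavierStokesRegularity.NavierStokesRegularity.Theorems.SoloSalvageWu2026ConstructGradLocal
import Summits.NavierStokesRegularity.NavierStokesRegularity.Theorems.SoloSalvageWu2026ConstructCompactV
import Summits.NavierStokesRegularity.NavierStokesRegularity.Theorems.SoloSalvageWu2026LogMass
import Literature.Analysis.FluidPDE.FlatSwirlGauge
import HarnessLib

/-!
# C177 `Wu2026` — the gradient bound (G1) of `Step_construct`: `sup_j ∫_{B(c,|c|/3)} |∇V_j| < ∞`
# at every scale, from the scale-invariant weak-`L^{9/5}` vorticity bound and the local div–curl
# estimate (cell `pub/ns-inputs`, seat `ns-in-wu-con`; route business of `GaldiLiouvilleGate`, item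
# stmt-NavierStokesRegularity-0897)

Discharge of hypothesis `hG1` of `step_construct_pieceA_of_localGradBound` (`…ConstructCompactV`):
for a Wu flow `v` and any scales `R_j = 2^{n_j}`, the blow-downs `V_j = R_j^{2/3}v(R_j·)` satisfy
`sup_j ∫_{B(c,|c|/3)} |DV_j| < ∞` for every `c ≠ 0` — (3.21)–(3.25) p.10–11: the vorticities
`curl V_j = R_j^{5/3}(curl v)(R_j·)` have the SAME weak-`L^{9/5}` quasinorm as `curl v`
(`eWeakLpPow_rescaled_le`), hence are bounded in `L^{3/2}` on bounded sets
(`MemWeakLp.setLIntegral_rpow_le`); `V_j` is bounded in `L^{3/2}` on the shell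
`B̄(c, 3|c|/8) ⊆ A_{3|c|/5} ∪ A_{7|c|/10}` by the scale-invariant annular bound (3.18)
(`integral_annulus_blowDown_rpow_le`); the local div–curl estimate (`exists_local_gradient_bound`,
from the tree's Calderón–Zygmund inequality) bounds `∫_{B(c,|c|/3)} |DV_j|^{3/2}`, and Hölder gives
the `L¹` bound.

Theorems only, standard axioms, no `sorry`.

WHAT THIS IS NOT: not a proof of `Step_construct` ((G2) and (B) remain); not a claim about NS
regularity or blow-up; not a claim about any author beyond the typed locator.
-/

set_option linter.dupNamespace false

noncomputable section

open MeasureTheory Set Filter Topology Module Metric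
open scoped ENNReal NNReal Topology RealInnerProductSpace Pointwise

namespace Summit.NavierStokesRegularity.NavierStokesRegularity.Theorems.Wu2026Salvage

open Literature.Analysis.FluidPDE Literature.Analysis.FunctionSpaces Literature.Claims.NS.Wu2026

/-- **Scale invariance of the weak quasinorm**: if `‖g(y)‖ = R^a ‖f(Ry)‖` with `R > 0`, `a r = 3`,
then `‖g‖^r_{r,∞} ≤ ‖f‖^r_{r,∞}` (the Lorentz-scale invariance (1.3) p.2: «‖Ω_R‖_{L^{9/5,ℓ}} =
‖ω‖_{L^{9/5,ℓ}}»). [cite: Wu2026, (1.3) p.2 l.10–17; (3.22) p.10] -/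
theorem eWeakLpPow_rescaled_le {F F' : Type*} [NormedAddCommGroup F] [NormedAddCommGroup F']
    (f : E3 → F) (g : E3 → F') {R a r : ℝ} (hR : 0 < R) (har : a * r = 3) (hr : 0 < r)
    (p : ℝ≥0∞) (hp : p.toReal = r) (hfg : ∀ y, ‖g y‖ = R ^ a * ‖f (R • y)‖) :
    eWeakLpPow g p volume ≤ eWeakLpPow f p volume := by
  rw [eWeakLpPow_le_iff]
  intro t
  rcases eq_or_lt_of_le (zero_le (a := t) : (0 : ℝ≥0) ≤ t) with ht | ht
  · rw [← ht, hp, ENNReal.coe_zero, ENNReal.zero_rpow_of_pos hr, zero_mul]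
    exact bot_le
  · have htr : 0 < (t : ℝ) := ht
    have hset : {x : E3 | (t : ℝ≥0∞) < ‖g x‖ₑ} = {x | (t : ℝ) < ‖g x‖} := by
      ext x
      simp only [mem_setOf_eq]
      rw [← ofReal_norm, ← ENNReal.ofReal_coe_nnreal,
        ENNReal.ofReal_lt_ofReal_iff_of_nonneg NNReal.zero_le_coe]
    rw [hset, hp]
    calc (t : ℝ≥0∞) ^ r * volume {x | (t : ℝ) < ‖g x‖}
        ≤ (t : ℝ≥0∞) ^ r * (eWeakLpPow f p volume * ENNReal.ofReal ((t : ℝ) ^ (-r))) := by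
          gcongr; exact meas_lt_norm_rescaled_le f g hR har p hp hfg htr
      _ = eWeakLpPow f p volume * ((t : ℝ≥0∞) ^ r * ENNReal.ofReal ((t : ℝ) ^ (-r))) := by ring
      _ = eWeakLpPow f p volume := by
          rw [← ENNReal.ofReal_rpow_of_pos htr, ENNReal.ofReal_coe_nnreal,
            ← ENNReal.rpow_add _ _ (ENNReal.coe_ne_zero.2 ht.ne') ENNReal.coe_ne_top,
            add_neg_cancel, ENNReal.rpow_zero, mul_one]

/-- **`curl V_R = R^{5/3}(curl v)(R·)` has the weak-`L^{9/5}` quasinorm of `curl v`** ((3.22) p.10: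
«‖Ω_j‖_{L^{9/5,∞}} = ‖ω‖_{L^{9/5,∞}} = M»). [cite: Wu2026, (3.22) p.10] -/
theorem eWeakLpPow_curl_blowDown_le (v : E3 → E3) {R : ℝ} (hR : 0 < R) :
    eWeakLpPow (curl (blowDown R v)) ((9 : ℝ≥0∞) / 5) volume ≤
      eWeakLpPow (curl v) ((9 : ℝ≥0∞) / 5) volume := by
  refine eWeakLpPow_rescaled_le (curl v) (curl (blowDown R v)) hR (a := (5 : ℝ) / 3)
    (r := (9 : ℝ) / 5) (by norm_num) (by norm_num) _ toReal_nine_fifths fun y => ?_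
  have h : curl (blowDown R v) y = (R ^ ((2 : ℝ) / 3) * R) • curl v (R • y) := by
    unfold blowDown
    exact curl_smul_comp_smul v _ _ y
  rw [h, norm_smul, Real.norm_of_nonneg (by positivity)]
  congr 1
  rw [← Real.rpow_add_one hR.ne']
  norm_num

/-- **The gradient bound (G1)** — hypothesis `hG1` of `step_construct_pieceA_of_localGradBound`
verbatim: at every scale, `sup_j ∫_{B(c,|c|/3)} |DV_j| < ∞` for `c ≠ 0`. [cite: Wu2026, (3.21)–(3.25) p.10–11] -/
theorem step_construct_gradBound_G1 :
    ∀ ν : ℝ, 0 < ν → ∀ (v : E3 → E3) (p : E3 → ℝ), IsWuFlow ν v p →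
      MemWeakLp v ((9 : ℝ≥0∞) / 2) volume →
      (∀ q : ℝ, 1 < q → q < 9 / 2 → ∃ C : ℝ, ∀ R : ℝ, 0 < R →
        IntegrableOn (fun x => ‖v x‖ ^ q) (annulus R) ∧
        (∫ x in annulus R, ‖v x‖ ^ q) ^ (1 / q) ≤ C * R ^ (-(2 : ℝ) / 3 + 3 / q)) →
      ∀ n : ℕ → ℕ, ∀ c : E3, c ≠ 0 → ∃ C : ℝ, ∀ j : ℕ,
        ∫ y in ball c (‖c‖ / 3), ‖fderiv ℝ (blowDown ((2 : ℝ) ^ n j) v) y‖ ≤ C := by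
  intro ν _hν v p hflow _hweak h318 n c hc
  have hc0 : 0 < ‖c‖ := norm_pos_iff.2 hc
  -- the rescaled fields
  set Vj : ℕ → E3 → E3 := fun j => blowDown ((2 : ℝ) ^ n j) v with hVj_def
  have hRpos : ∀ j, (0 : ℝ) < (2 : ℝ) ^ n j := fun j => pow_pos two_pos _
  have hVs : ∀ j, ContDiff ℝ (⊤ : ℕ∞) (Vj j) := fun j => contDiff_blowDown hflow.smooth_v _
  have hV1 : ∀ j, ContDiff ℝ 1 (Vj j) := fun j => (hVs j).of_le (by norm_cast)
  have hVc : ∀ j, Continuous (Vj j) := fun j => (hVs j).continuous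
  have hDVc : ∀ j, Continuous (fderiv ℝ (Vj j)) := fun j => (hV1 j).continuous_fderiv one_ne_zero
  have hdiv : ∀ j, VectorCalculus.IsDivFree (Vj j) := fun j =>
    (isLerayProfile_blowDown hflow.profile (hRpos j)).divFree
  have hcurlc : ∀ j, Continuous (curl (Vj j)) := fun j => continuous_curl (hV1 j)
  -- geometry: `B = B(c, |c|/3)`, `S = B̄(c, 3|c|/8) ⊆ A_{3|c|/5} ∪ A_{7|c|/10}`
  set r : ℝ := ‖c‖ / 3 with hr_def
  set r' : ℝ := 3 * ‖c‖ / 8 with hr'_def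
  have hr : 0 < r := by positivity
  have hrr' : r < r' := by rw [hr_def, hr'_def]; linarith
  set S : Set E3 := closedBall c r' with hS_def
  have hSfin : volume S ≠ ∞ := (isCompact_closedBall c r').measure_lt_top.ne
  have hSsub : S ⊆ annulus (3 * ‖c‖ / 5) ∪ annulus (7 * ‖c‖ / 10) := by
    intro y hy
    rw [hS_def, mem_closedBall, dist_eq_norm] at hy
    have h1 : ‖y‖ ≤ ‖c‖ + ‖y - c‖ := by
      calc ‖y‖ = ‖c + (y - c)‖ := by rw [add_sub_cancel]
        _ ≤ ‖c‖ + ‖y - c‖ := norm_add_le _ _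
    have h2 : ‖c‖ ≤ ‖y‖ + ‖y - c‖ := by
      calc ‖c‖ = ‖y - (y - c)‖ := by rw [sub_sub_cancel]
        _ ≤ ‖y‖ + ‖y - c‖ := norm_sub_le _ _
    by_cases hlt : ‖y‖ < 6 * ‖c‖ / 5
    · left; exact ⟨by rw [hr'_def] at hy; linarith, by linarith⟩
    · right; exact ⟨by have := not_lt.1 hlt; linarith, by rw [hr'_def] at hy; linarith⟩
  -- the local div–curl estimate with `q = 3/2`
  obtain ⟨C, hCtop, hC⟩ := exists_local_gradient_bound (by norm_num : (1 : ℝ) < 3 / 2) c hr hrr'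
  -- (a) uniform `L^{3/2}` bound of `V_j` on `S` from (3.18)
  obtain ⟨Cq, hCq⟩ := h318 ((3 : ℝ) / 2) (by norm_num) (by norm_num)
  have hann : ∀ {T : ℝ}, 0 < T → ∀ j, ∫⁻ y in annulus T, ‖Vj j y‖ₑ ^ ((3 : ℝ) / 2) ≤
      ENNReal.ofReal ((Cq * T ^ (-(2 : ℝ) / 3 + 3 / ((3 : ℝ) / 2))) ^ ((3 : ℝ) / 2)) := by
    intro T hT j
    have hcont : Continuous fun y => ‖Vj j y‖ ^ ((3 : ℝ) / 2) :=
      (hVc j).norm.rpow_const fun _ => Or.inr (by norm_num)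
    calc ∫⁻ y in annulus T, ‖Vj j y‖ₑ ^ ((3 : ℝ) / 2)
        = ∫⁻ y in annulus T, ENNReal.ofReal (‖Vj j y‖ ^ ((3 : ℝ) / 2)) :=
          lintegral_congr fun y => (ofReal_norm_rpow _ (by norm_num)).symm
      _ = ENNReal.ofReal (∫ y in annulus T, ‖Vj j y‖ ^ ((3 : ℝ) / 2)) :=
          (ofReal_integral_eq_lintegral_ofReal (integrableOn_annulus_of_continuous hcont _)
            (Eventually.of_forall fun y => Real.rpow_nonneg (norm_nonneg _) _)).symm
      _ ≤ _ := ENNReal.ofReal_le_ofReal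
          (integral_annulus_blowDown_rpow_le (by norm_num) hCq (hRpos j) hT)
  set MV : ℝ≥0∞ := ENNReal.ofReal ((Cq * (3 * ‖c‖ / 5) ^ (-(2 : ℝ) / 3 + 3 / ((3 : ℝ) / 2))) ^
      ((3 : ℝ) / 2)) + ENNReal.ofReal ((Cq * (7 * ‖c‖ / 10) ^ (-(2 : ℝ) / 3 + 3 / ((3 : ℝ) / 2))) ^
      ((3 : ℝ) / 2)) with hMV
  have hMVtop : MV ≠ ∞ := ENNReal.add_ne_top.2 ⟨ENNReal.ofReal_ne_top, ENNReal.ofReal_ne_top⟩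
  have hIV : ∀ j, ∫⁻ y in S, ‖Vj j y‖ₑ ^ ((3 : ℝ) / 2) ≤ MV := fun j =>
    calc ∫⁻ y in S, ‖Vj j y‖ₑ ^ ((3 : ℝ) / 2)
        ≤ ∫⁻ y in annulus (3 * ‖c‖ / 5) ∪ annulus (7 * ‖c‖ / 10), ‖Vj j y‖ₑ ^ ((3 : ℝ) / 2) :=
          lintegral_mono_set hSsub
      _ ≤ (∫⁻ y in annulus (3 * ‖c‖ / 5), ‖Vj j y‖ₑ ^ ((3 : ℝ) / 2)) +
            ∫⁻ y in annulus (7 * ‖c‖ / 10), ‖Vj j y‖ₑ ^ ((3 : ℝ) / 2) := lintegral_union_le _ _ _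
      _ ≤ MV := add_le_add (hann (by positivity) j) (hann (by positivity) j)
  -- (b) uniform `L^{3/2}` bound of `curl V_j` on `S` from the weak `L^{9/5}` bound
  set W : ℝ≥0∞ := eWeakLpPow (curl v) ((9 : ℝ≥0∞) / 5) volume with hW
  have hWtop : W ≠ ∞ := hflow.weakVort.2.ne
  set Mc : ℝ≥0∞ := volume S * ENNReal.ofReal ((1 : ℝ) ^ ((3 : ℝ) / 2)) +
      ENNReal.ofReal (((3 : ℝ) / 2) / (((9 : ℝ≥0∞) / 5).toReal - (3 : ℝ) / 2) *
        (1 : ℝ) ^ ((3 : ℝ) / 2 - ((9 : ℝ≥0∞) / 5).toReal)) * W with hMc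
  have hMctop : Mc ≠ ∞ := ENNReal.add_ne_top.2
    ⟨ENNReal.mul_ne_top hSfin ENNReal.ofReal_ne_top, ENNReal.mul_ne_top ENNReal.ofReal_ne_top hWtop⟩
  have hIc : ∀ j, ∫⁻ y in S, ‖curl (Vj j) y‖ₑ ^ ((3 : ℝ) / 2) ≤ Mc := by
    intro j
    have h := MemWeakLp.setLIntegral_rpow_le (p := (9 : ℝ≥0∞) / 5) (μ := volume)
      (f := curl (Vj j)) (hcurlc j).aestronglyMeasurable (r := (3 : ℝ) / 2) (by norm_num)
      (by rw [toReal_nine_fifths]; norm_num) S one_pos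
    refine h.trans ?_
    simp only [hMc]
    gcongr
    exact eWeakLpPow_curl_blowDown_le v (hRpos j)
  -- (c) the local estimate and Hölder
  set Z : ℝ≥0∞ := C * (Mc + MV) with hZ
  have hZtop : Z ≠ ∞ := ENNReal.mul_ne_top hCtop (ENNReal.add_ne_top.2 ⟨hMctop, hMVtop⟩)
  have hgrad : ∀ j, ∫⁻ y in ball c r, ‖fderiv ℝ (Vj j) y‖ₑ ^ ((3 : ℝ) / 2) ≤ Z := fun j =>
    (hC (Vj j) (hVs j) (hdiv j)).trans (by rw [hZ]; gcongr; exacts [hIc j, hIV j])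
  have hBfin : volume (ball c r) ≠ ∞ := measure_ball_lt_top.ne
  set Z1 : ℝ≥0∞ := Z ^ ((1 : ℝ) / ((3 : ℝ) / 2)) * volume (ball c r) ^ (1 - 1 / ((3 : ℝ) / 2))
    with hZ1
  have hZ1top : Z1 ≠ ∞ := ENNReal.mul_ne_top (ENNReal.rpow_ne_top_of_nonneg (by norm_num) hZtop)
    (ENNReal.rpow_ne_top_of_nonneg (by norm_num) hBfin)
  have hL1 : ∀ j, ∫⁻ y in ball c r, ‖fderiv ℝ (Vj j) y‖ₑ ≤ Z1 := by
    intro j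
    have h := setLIntegral_rpow_le_of_lt (K := ball c r) ((hDVc j).aestronglyMeasurable.enorm.restrict)
      (s := 1) (r := (3 : ℝ) / 2) one_pos (by norm_num)
    simp only [ENNReal.rpow_one] at h
    refine h.trans ?_
    rw [hZ1]
    gcongr
    exact hgrad j
  refine ⟨Z1.toReal, fun j => ?_⟩
  show ∫ y in ball c r, ‖fderiv ℝ (Vj j) y‖ ≤ Z1.toReal
  rw [integral_norm_eq_lintegral_enorm (hDVc j).aestronglyMeasurable.restrict]
  exact ENNReal.toReal_mono hZ1top (hL1 j)

end Summit.NavierStokesRegularity.NavierStokesRegularity.Theorems.Wu2026Salvage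

end

-- WHAT THIS IS NOT: not a claim about NS regularity or blow-up; not a claim about any author beyond the typed locator.
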